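import Mathlib.MeasureTheory.Integral.IntegrableOn
import Literature.Probability.LatticeModels.LocalParafermionicTemplate
import Literature.Probability.LatticeModels.MedialInterfaceMeasurability
import Literature.Probability.LatticeModels.ObservableAprioriBound
import HarnessLib

/-!
# The template integrand of an admissible domain is `P_{1/2}`-integrable
(stub `stub_integrandIntegrable` of line `birth`, crux `CardyDualCurrent.DualCurrentTemplateR`,
stmt-CriticalPhenomena-11201)

The integrand of the template observable `T.obs D x i`
(`LocalParafermionicTemplate.obs_eq`),
`ω ↦ ∑_k g i k {e | edist (s(0,e_i)) e ≤ r ∧ x + e ∈ ω} ·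
  passageSum (fkInterface D ω) δ (s i k) (x + z i k)`,
is integrable under Bernoulli bond percolation `bondPercolation (zdGraph 2) half` for every
admissible discrete Dobrushin domain `D`: it is measurable and bounded on a probability space.

* The local-weight factor reads `ω` only through the finitely many coordinates `x + e`, `e` in
  the window `{e | edist (s(0,e_i)) e ≤ r}` (a finite set of lattice edges,
  `LocalParafermionicTemplate.mem_edgeSet_and_coord_bound_of_edist_le`), so each of its level
  events is determined by a finite set of edges (`DeterminedBy.measurableSet_of_finset`) and it
  takes at most `2^|window|` values (bounded by the sum of their norms).
* The passage factor depends on `ω` only through `medialExploration D ω`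
  (`measurable_of_medialExploration`) and has norm `≤ 2` (`norm_passageSum_fkInterface_le_two`).

The registered signature is the NAME `Sig.stub_integrandIntegrable` of the (non-importable) line
skeleton (`Cruxes/DualCurrentTemplateR/Lines/birth.lean`, namespace
`…Cruxes.DualCurrentTemplateR.Birth`); it is restated here verbatim-unfolded as
`Sig.stub_integrandIntegrable` (a `def … : Prop`, asserted nowhere, the type of
`stub_integrandIntegrable`), next to the def-free form `integrable_templateIntegrand`
(definitionally `Integrable (integrand T D · x i) P_{1/2}` for the skeleton's `integrand`).
Bookkeeping lemmas live in the sub-namespace `StubIntegrandIntegrable`.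
-/

noncomputable section

namespace Summit.CriticalPhenomena.CardyFormulaZ2.Theorems

open MeasureTheory Literature.Probability Literature.Probability.LatticeModels

namespace StubIntegrandIntegrable

/-! ### Bookkeeping: the two factors are measurable and bounded -/

/-- The medial ball of radius `r` around the base vertex `s(0, e_i)` is finite: its members are
lattice edges with endpoint coordinates of absolute value `≤ r + 1`. -/
theorem finite_setOf_edist_baseVertex_le (i : Fin 2) (r : ℕ) :
    {e : MedialVertex |
      medialGraph.edist s((0 : Site 2), Pi.single i 1) e ≤ (r : ℕ∞)}.Finite := by
  have hS : {v : Site 2 | ∀ j, |v j| ≤ (r : ℤ) + 1}.Finite := by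
    refine (Fintype.piFinset fun _ : Fin 2 =>
      Finset.Icc (-((r : ℤ) + 1)) ((r : ℤ) + 1)).finite_toSet.subset ?_
    intro v hv
    rw [Finset.mem_coe, Fintype.mem_piFinset]
    exact fun j => Finset.mem_Icc.2 (abs_le.1 (hv j))
  refine ((hS.prod hS).image fun p : Site 2 × Site 2 => s(p.1, p.2)).subset ?_
  intro e he
  obtain ⟨-, hcoord⟩ := LocalParafermionicTemplate.mem_edgeSet_and_coord_bound_of_edist_le he
  induction e using Sym2.ind with
  | h a b =>
    exact ⟨(a, b), ⟨fun j => hcoord a (Sym2.mem_mk_left a b) j,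
      fun j => hcoord b (Sym2.mem_mk_right a b) j⟩, rfl⟩

/-- The pattern of `ω` seen in the translated window (in relative coordinates) is determined by
the coordinates of `ω` in the translate of the window. -/
theorem windowPattern_congr (i : Fin 2) (r : ℕ) (x : Site 2)
    {ω ω' : Percolation.BondConfig (Site 2)}
    (h : ω ∩ ↑((finite_setOf_edist_baseVertex_le i r).toFinset.image (Sym2.map (· + x))) =
      ω' ∩ ↑((finite_setOf_edist_baseVertex_le i r).toFinset.image (Sym2.map (· + x)))) :
    {e : MedialVertex | medialGraph.edist s((0 : Site 2), Pi.single i 1) e ≤ (r : ℕ∞) ∧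
        Sym2.map (· + x) e ∈ ω} =
      {e : MedialVertex | medialGraph.edist s((0 : Site 2), Pi.single i 1) e ≤ (r : ℕ∞) ∧
        Sym2.map (· + x) e ∈ ω'} := by
  ext e
  simp only [Set.mem_setOf_eq]
  refine and_congr_right fun he => ?_
  have hex : Sym2.map (· + x) e ∈
      (↑((finite_setOf_edist_baseVertex_le i r).toFinset.image (Sym2.map (· + x))) :
        Set MedialVertex) := by
    rw [Finset.coe_image]
    exact ⟨e, by simpa using he, rfl⟩
  constructor
  · intro hω
    exact ((Set.ext_iff.1 h _).1 ⟨hω, hex⟩).1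
  · intro hω'
    exact ((Set.ext_iff.1 h _).2 ⟨hω', hex⟩).1

/-- The local-weight factor `ω ↦ g {e | edist (s(0,e_i)) e ≤ r ∧ x + e ∈ ω}` is measurable:
each of its level events is determined by the finitely many edges of the translated window. -/
theorem measurable_localWeight (g : Set MedialVertex → ℂ) (i : Fin 2) (r : ℕ) (x : Site 2) :
    Measurable fun ω : Percolation.BondConfig (Site 2) =>
      g {e : MedialVertex | medialGraph.edist s((0 : Site 2), Pi.single i 1) e ≤ (r : ℕ∞) ∧
        Sym2.map (· + x) e ∈ ω} := by
  intro t _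
  refine Percolation.DeterminedBy.measurableSet_of_finset
    (F := (finite_setOf_edist_baseVertex_le i r).toFinset.image (Sym2.map (· + x)))
    ((Percolation.determinedBy_iff _ _).2 fun ω ω' h => ?_)
  simp only [Set.mem_preimage]
  rw [windowPattern_congr i r x h]

/-- The local-weight factor is bounded: the pattern is a subset of the finite window, so the
factor takes finitely many values. -/
theorem norm_localWeight_le (g : Set MedialVertex → ℂ) (i : Fin 2) (r : ℕ) (x : Site 2)
    (ω : Percolation.BondConfig (Site 2)) :
    ‖g {e : MedialVertex | medialGraph.edist s((0 : Site 2), Pi.single i 1) e ≤ (r : ℕ∞) ∧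
        Sym2.map (· + x) e ∈ ω}‖ ≤
      ∑ S ∈ (finite_setOf_edist_baseVertex_le i r).toFinset.powerset,
        ‖g (↑S : Set MedialVertex)‖ := by
  have hsub : {e : MedialVertex |
      medialGraph.edist s((0 : Site 2), Pi.single i 1) e ≤ (r : ℕ∞) ∧ Sym2.map (· + x) e ∈ ω} ⊆
      {e : MedialVertex | medialGraph.edist s((0 : Site 2), Pi.single i 1) e ≤ (r : ℕ∞)} :=
    fun e he => he.1
  have hfin := (finite_setOf_edist_baseVertex_le i r).subset hsub
  have hmem : hfin.toFinset ∈ (finite_setOf_edist_baseVertex_le i r).toFinset.powerset := by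
    rw [Finset.mem_powerset]
    exact Set.Finite.toFinset_subset_toFinset.2 hsub
  have := Finset.single_le_sum
    (f := fun S : Finset MedialVertex => ‖g (↑S : Set MedialVertex)‖)
    (fun _ _ => norm_nonneg _) hmem
  simpa only [Set.Finite.coe_toFinset] using this

/-- The passage factor `ω ↦ passageSum (fkInterface D ω) δ spin z` is measurable: it depends on
`ω` only through the medial exploration. -/
theorem measurable_passageSum_fkInterface (D : DiscreteDobrushin) (δ spin : ℝ)
    (z : MedialVertex) :
    Measurable fun ω : Percolation.BondConfig (Site 2) =>
      passageSum (fkInterface D ω) δ spin z :=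
  measurable_of_medialExploration D fun _ _ h => congrArg (passageSum · δ spin z) h

end StubIntegrandIntegrable

open StubIntegrandIntegrable

/-! ### The stub -/

/-- **The template integrand is integrable** (def-free form of the stub): in an admissible
discrete Dobrushin domain `D`, for every template `T`, base point `x` and type `i`, the integrand
`ω ↦ ∑_k g i k {e | edist (s(0,e_i)) e ≤ r ∧ x + e ∈ ω} ·
  passageSum (fkInterface D ω) δ (s i k) (x + z i k)`
of `T.obs D x i` is integrable under `bondPercolation (zdGraph 2) half`: a finite sum of products
of a bounded measurable local-weight factor and a bounded measurable passage factor, on a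
probability space (`Integrable.of_bound`). -/
theorem integrable_templateIntegrand (T : LocalParafermionicTemplate) (D : DiscreteDobrushin)
    (hD : D.IsZdAdmissible) (x : Site 2) (i : Fin 2) :
    Integrable (fun ω : Percolation.BondConfig (Site 2) =>
        ∑ k, T.g i k {e |
            medialGraph.edist s((0 : Site 2), Pi.single i 1) e ≤ (T.r : ℕ∞) ∧
              Sym2.map (· + x) e ∈ ω} *
          passageSum (fkInterface D ω) D.δ (T.s i k) (Sym2.map (· + x) (T.z i k)))
      (Percolation.bondPercolation (zdGraph 2) Percolation.half) := by
  refine integrable_finsetSum _ fun k _ => ?_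
  have hm : Measurable fun ω : Percolation.BondConfig (Site 2) =>
      T.g i k {e | medialGraph.edist s((0 : Site 2), Pi.single i 1) e ≤ (T.r : ℕ∞) ∧
          Sym2.map (· + x) e ∈ ω} *
        passageSum (fkInterface D ω) D.δ (T.s i k) (Sym2.map (· + x) (T.z i k)) :=
    (measurable_localWeight (T.g i k) i T.r x).mul
      (measurable_passageSum_fkInterface D D.δ (T.s i k) _)
  refine Integrable.of_bound hm.aestronglyMeasurable
    ((∑ S ∈ (finite_setOf_edist_baseVertex_le i T.r).toFinset.powerset,
      ‖T.g i k (↑S : Set MedialVertex)‖) * 2) (ae_of_all _ fun ω => ?_)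
  exact (norm_mul_le _ _).trans (mul_le_mul (norm_localWeight_le (T.g i k) i T.r x ω)
    (norm_passageSum_fkInterface_le_two hD ω _ _ _) (norm_nonneg _)
    ((norm_nonneg _).trans (norm_localWeight_le (T.g i k) i T.r x ω)))

/-- The registered signature `Sig.stub_integrandIntegrable` of the line skeleton
(`Cruxes/DualCurrentTemplateR/Lines/birth.lean`, namespace `…Cruxes.DualCurrentTemplateR.Birth`,
not an importable module), restated VERBATIM in unfolded form: in an admissible domain the
template integrand is `P_{1/2}`-integrable. A statement only — it is the type of
`stub_integrandIntegrable` below and is asserted nowhere else. -/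
def Sig.stub_integrandIntegrable : Prop :=
  ∀ (T : LocalParafermionicTemplate) (D : DiscreteDobrushin), D.IsZdAdmissible →
    ∀ (x : Site 2) (i : Fin 2),
      Integrable (fun ω : Percolation.BondConfig (Site 2) =>
          ∑ k, T.g i k {e | medialGraph.edist s((0 : Site 2), Pi.single i 1) e ≤ (T.r : ℕ∞) ∧
              Sym2.map (· + x) e ∈ ω} *
            passageSum (fkInterface D ω) D.δ (T.s i k) (Sym2.map (· + x) (T.z i k)))
        (Percolation.bondPercolation (zdGraph 2) Percolation.half)

/-- Registered stub `stub_integrandIntegrable` (signature `Sig.stub_integrandIntegrable`, unfolded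
verbatim) of line `birth` of crux stmt-CriticalPhenomena-11201
(`CardyDualCurrent.DualCurrentTemplateR`). In an admissible discrete Dobrushin domain the
template integrand is `P_{1/2}`-integrable: it is a finite sum of products of a bounded
measurable local-weight factor and a bounded measurable passage factor, on a probability space
(`integrable_templateIntegrand`). -/
theorem stub_integrandIntegrable : Sig.stub_integrandIntegrable :=
  integrable_templateIntegrand

end Summit.CriticalPhenomena.CardyFormulaZ2.Theorems

end
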